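import Literature.AlgebraicGeometry.Resolution.DecompletionControl
import Literature.AlgebraicGeometry.Resolution.DecompletionValuative
import HarnessLib

/-!
# Temkin's decompletion lemma, algebraic proof — data for the polydisc chart

Topic: `Literature/AlgebraicGeometry/Resolution`. M. Temkin, *Inseparable local uniformization*,
J. Algebra 373 (2013) 65–119 = arXiv:0804.1554v3, Lemma 3.3.2 (tree: `Temkin2013_Lemma332_nft`).

For the chart `C : DecompChart V O A φ` (`Rh ≅ (k[X][W]/F)[1/G]`, `DecompletionSetup.lean`) this
file prepares the INTEGRAL data from which the `m°`-polydisc chart `E` is built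
(`DecompletionPolydiscAlgebra.lean`): the `W`-variable is rescaled (`w′ = π^d w`) and all
polynomials are multiplied by powers of `π` so that their coefficients lie in `k°`, the values at
the point lie in (and are integral over the image of) `k°`, and every element `z ∈ Rh` acquires
an integral representation `z · G₁(T, w′)^N · π^a = Φ₁(T, w′)·π^{N a_G}`.

* `IsVInt`, `exists_pow_mul_isVInt`, `IsVInt.exists_lift` — `k°`-integrality of bivariate
  polynomials over `k[X₁,…,X_n]`, uniform clearing of denominators, lifting to `k°` — PROVED;
* `scaleW d a Φ = π^a Φ(X, W/π^d)` with `aeval_scaleW`, `aeval_derivative_scaleW`,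
  `exists_isVInt_scaleW` — PROVED;
* `pointVal Ψ b = Ψ(0, b)` and its naturality — PROVED;
* chart constants: `dW`, `w′`, `w₀′` (integral), `F₁, G₁` (integral rescalings of `F, G`),
  their lifts `FV, GV`, the values `c₀′ = ∂_W F₁(0, w₀′) ≠ 0`, `g₀′ = G₁(0, w₀′) ≠ 0` and
  integral `ι₀, κ₀` with `c₀′ι₀ = π^{N₀}`, `g₀′κ₀ = π^{N_g}` — PROVED;
* `repΦ z, repN z, repa z` — an integral representation of any `z ∈ Rh`, with the value
  identity `repΦ₁(0, w₀′)·κ₀^N π^{N a_G} = π^{b_z}·z(x)` (`pointVal_repΦO_mul`) — PROVED.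

The generic polynomial book-keeping (`IsVInt`, `pointVal`, `scaleW`, …) lives in the sub-namespace
`Polydisc`; the chart data under `DecompChart` (the image of `k°` in `m` is `baseRing m V` of
`DecompletionSetup.lean`). All statements are [folklore]; no named facts.

## Sources

* M. Temkin, arXiv:0804.1554v3, proof of Lemma 3.3.2 (pp. 45–46).
-/

noncomputable section

open Polynomial

namespace Literature.AlgebraicGeometry.Resolution

universe u

variable {k K m : Type u} [Field k] [Field K] [Algebra k K] [Field m] [Algebra k m]

namespace Polydisc

/-! ### `k°`-integral bivariate polynomials over `k[X₁, …, X_n]` -/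

section VInt

variable (V : ValuationSubring k) {n : ℕ}

omit [Algebra k K] in
/-- All coefficients of `Φ ∈ k[X₁,…,X_n][W]` lie in `k°`. [folklore] -/
def IsVInt (Φ : (MvPolynomial (Fin n) k)[X]) : Prop := ∀ i mo, (Φ.coeff i).coeff mo ∈ V

variable {V}

/-- `IsVInt` is additive. [folklore] -/
theorem IsVInt.add {Φ Ψ : (MvPolynomial (Fin n) k)[X]} (hΦ : IsVInt V Φ) (hΨ : IsVInt V Ψ) :
    IsVInt V (Φ + Ψ) := fun i mo => by
  rw [coeff_add, MvPolynomial.coeff_add]; exact add_mem (hΦ i mo) (hΨ i mo)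

/-- `IsVInt` is multiplicative. [folklore] -/
theorem IsVInt.mul {Φ Ψ : (MvPolynomial (Fin n) k)[X]} (hΦ : IsVInt V Φ) (hΨ : IsVInt V Ψ) :
    IsVInt V (Φ * Ψ) := fun i mo => by
  rw [coeff_mul, MvPolynomial.coeff_sum]
  refine Subring.sum_mem _ fun x _ => ?_
  rw [MvPolynomial.coeff_mul]
  exact Subring.sum_mem _ fun y _ => mul_mem (hΦ _ _) (hΨ _ _)

/-- Scaling by an element of `k°` preserves integrality. [folklore] -/
theorem IsVInt.C_mul {Φ : (MvPolynomial (Fin n) k)[X]} (hΦ : IsVInt V Φ) {c : k} (hc : c ∈ V) :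
    IsVInt V (C (MvPolynomial.C c) * Φ) := fun i mo => by
  rw [coeff_C_mul, MvPolynomial.coeff_C_mul]; exact mul_mem hc (hΦ i mo)

/-- `X_j` is integral. [folklore] -/
theorem isVInt_C_X (j : Fin n) : IsVInt V (C (MvPolynomial.X j) : (MvPolynomial (Fin n) k)[X]) :=
  fun i mo => by
  rw [coeff_C]
  split_ifs
  · rw [MvPolynomial.coeff_X]; split_ifs <;> simp [V.one_mem, V.zero_mem]
  · simp [V.zero_mem]

/-- `W` is integral. [folklore] -/
theorem isVInt_X : IsVInt V (X : (MvPolynomial (Fin n) k)[X]) := fun i mo => by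
  rw [coeff_X]
  split_ifs
  · rw [MvPolynomial.coeff_one]; split_ifs <;> simp [V.one_mem, V.zero_mem]
  · simp [V.zero_mem]

/-- Constants from `k°` are integral. [folklore] -/
theorem isVInt_C_C {c : k} (hc : c ∈ V) : IsVInt V (C (MvPolynomial.C c) : (MvPolynomial (Fin n) k)[X]) :=
  fun i mo => by
  rw [coeff_C]
  split_ifs
  · rw [MvPolynomial.coeff_C]; split_ifs
    · exact hc
    · exact V.zero_mem
  · simp [V.zero_mem]

variable (V)

/-- Uniform clearing of denominators for one multivariate polynomial. [folklore] -/
theorem exists_pow_mul_coeff_mem (hdim : ringKrullDim V = 1) {π : k} (hπV : π ∈ V)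
    (hπ : V.valuation π < 1) (Q : MvPolynomial (Fin n) k) :
    ∃ N : ℕ, ∀ mo, π ^ N * Q.coeff mo ∈ V := by
  classical
  have hmono : ∀ {z : k} {a b : ℕ}, a ≤ b → π ^ a * z ∈ V → π ^ b * z ∈ V := by
    intro z a b hab h
    obtain ⟨c, rfl⟩ := Nat.exists_eq_add_of_le hab
    rw [add_comm, pow_add, mul_assoc]
    exact mul_mem (pow_mem hπV c) h
  choose N hN using fun mo => exists_pow_mul_mem_of_ringKrullDim_eq_one V hdim hπV hπ (Q.coeff mo)
  refine ⟨Q.support.sup N, fun mo => ?_⟩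
  by_cases hmo : mo ∈ Q.support
  · exact hmono (Finset.le_sup hmo) (hN mo)
  · rw [MvPolynomial.notMem_support_iff.mp hmo, mul_zero]; exact V.zero_mem

/-- **Uniform clearing of denominators**: `π^N Φ` is `k°`-integral for `N ≫ 0`. [folklore] -/
theorem exists_pow_mul_isVInt (hdim : ringKrullDim V = 1) {π : k} (hπV : π ∈ V)
    (hπ : V.valuation π < 1) (Φ : (MvPolynomial (Fin n) k)[X]) :
    ∃ N : ℕ, ∀ N', N ≤ N' → IsVInt V (C (MvPolynomial.C (π ^ N')) * Φ) := by
  classical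
  have hmono : ∀ {z : k} {a b : ℕ}, a ≤ b → π ^ a * z ∈ V → π ^ b * z ∈ V := by
    intro z a b hab h
    obtain ⟨c, rfl⟩ := Nat.exists_eq_add_of_le hab
    rw [add_comm, pow_add, mul_assoc]
    exact mul_mem (pow_mem hπV c) h
  choose N hN using fun i => exists_pow_mul_coeff_mem V hdim hπV hπ (Φ.coeff i)
  refine ⟨Φ.support.sup N, fun N' hN' i mo => ?_⟩
  rw [coeff_C_mul, MvPolynomial.coeff_C_mul]
  by_cases hi : i ∈ Φ.support
  · exact hmono (le_trans (Finset.le_sup hi) hN') (hN i mo)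
  · rw [Polynomial.notMem_support_iff.mp hi, MvPolynomial.coeff_zero, mul_zero]; exact V.zero_mem

omit [Algebra k K] in
/-- A multivariate polynomial with coefficients in `k°` lifts to `k°`. [folklore] -/
theorem exists_mvPolynomial_map_eq (Q : MvPolynomial (Fin n) k) (hQ : ∀ mo, Q.coeff mo ∈ V) :
    ∃ Q' : MvPolynomial (Fin n) V, MvPolynomial.map (algebraMap V k) Q' = Q := by
  classical
  refine ⟨∑ mo ∈ Q.support, MvPolynomial.monomial mo ⟨Q.coeff mo, hQ mo⟩, ?_⟩
  rw [map_sum]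
  simp only [MvPolynomial.map_monomial]
  conv_rhs => rw [MvPolynomial.as_sum Q]
  rfl

/-- **A `k°`-integral bivariate polynomial lifts to `k°[X₁,…,X_n][W]`.** [folklore] -/
theorem IsVInt.exists_lift {Φ : (MvPolynomial (Fin n) k)[X]} (hΦ : IsVInt V Φ) :
    ∃ ΦV : (MvPolynomial (Fin n) V)[X],
      ΦV.map (MvPolynomial.map (algebraMap V k)) = Φ := by
  have : Φ ∈ Polynomial.lifts (MvPolynomial.map (σ := Fin n) (algebraMap V k)) := by
    rw [Polynomial.lifts_iff_coeff_lifts]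
    intro i
    obtain ⟨Q', hQ'⟩ := exists_mvPolynomial_map_eq V (Φ.coeff i) (hΦ i)
    exact ⟨Q', hQ'⟩
  exact (Polynomial.mem_lifts _).mp this

end VInt

/-! ### The value at a point `(0, b)` of a bivariate polynomial -/

section PointVal

variable {R₁ R₂ : Type*} [CommRing R₁] [CommRing R₂] {n : ℕ}

/-- `Ψ(0, b)`: set the polydisc variables to `0` and `W` to `b`. [folklore] -/
def pointVal (Ψ : (MvPolynomial (Fin n) R₁)[X]) (b : R₁) : R₁ :=
  MvPolynomial.constantCoeff (Ψ.eval (MvPolynomial.C b))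

/-- `Ψ(0, b) = (Ψ with coefficients evaluated at 0)(b)`. [folklore] -/
theorem pointVal_eq (Ψ : (MvPolynomial (Fin n) R₁)[X]) (b : R₁) :
    pointVal Ψ b = (Ψ.map (MvPolynomial.constantCoeff : MvPolynomial (Fin n) R₁ →+* R₁)).eval b := by
  rw [pointVal, Polynomial.eval_map]
  change MvPolynomial.constantCoeff (Ψ.eval₂ (RingHom.id _) (MvPolynomial.C b)) = _
  rw [Polynomial.hom_eval₂, RingHom.comp_id, MvPolynomial.constantCoeff_C]

/-- Naturality of `pointVal` in the coefficient ring. [folklore] -/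
theorem map_pointVal (θ : R₁ →+* R₂) (Ψ : (MvPolynomial (Fin n) R₁)[X]) (b : R₁) :
    θ (pointVal Ψ b) = pointVal (Ψ.map (MvPolynomial.map θ)) (θ b) := by
  rw [pointVal_eq, pointVal_eq, Polynomial.map_map]
  change θ ((Ψ.map MvPolynomial.constantCoeff).eval₂ (RingHom.id _) b) = _
  rw [Polynomial.hom_eval₂, RingHom.comp_id, Polynomial.eval₂_eq_eval_map, Polynomial.map_map]
  congr 2

/-- `pointVal` of a derivative commutes with coefficient maps. [folklore] -/
theorem map_pointVal_derivative (θ : R₁ →+* R₂) (Ψ : (MvPolynomial (Fin n) R₁)[X]) (b : R₁) :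
    θ (pointVal (derivative Ψ) b) =
      pointVal (derivative (Ψ.map (MvPolynomial.map θ))) (θ b) := by
  rw [map_pointVal, Polynomial.derivative_map]

end PointVal

/-! ### Rescaling the Newton variable: `π^a Φ(X, W/π^d)` -/

section ScaleW

variable {n : ℕ}

omit [Algebra k K] in
/-- `scaleW π d a Φ = π^a · Φ(X, W/π^d)`. [folklore] -/
def scaleW (π : k) (d a : ℕ) (Φ : (MvPolynomial (Fin n) k)[X]) : (MvPolynomial (Fin n) k)[X] :=
  C (MvPolynomial.C (π ^ a)) * Φ.comp (C (MvPolynomial.C ((π ^ d)⁻¹)) * X)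

omit [Algebra k K] in
/-- `(scaleW Φ)(π^d w) = π^a Φ(w)`. [folklore] -/
theorem aeval_scaleW {S : Type*} [CommRing S] [Algebra (MvPolynomial (Fin n) k) S] {π : k}
    (hπ : π ≠ 0) (d a : ℕ) (Φ : (MvPolynomial (Fin n) k)[X]) (w : S) :
    aeval (algebraMap (MvPolynomial (Fin n) k) S (MvPolynomial.C (π ^ d)) * w) (scaleW π d a Φ) =
      algebraMap (MvPolynomial (Fin n) k) S (MvPolynomial.C (π ^ a)) * aeval w Φ := by
  rw [scaleW, map_mul, aeval_C, aeval_comp, map_mul, aeval_C, aeval_X, ← mul_assoc, ← map_mul,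
    ← map_mul, inv_mul_cancel₀ (pow_ne_zero d hπ), map_one, map_one, one_mul]

omit [Algebra k K] in
/-- `(scaleW Φ)′(π^d w) = π^a (π^d)⁻¹ Φ′(w)`. [folklore] -/
theorem aeval_derivative_scaleW {S : Type*} [CommRing S] [Algebra (MvPolynomial (Fin n) k) S]
    {π : k} (hπ : π ≠ 0) (d a : ℕ) (Φ : (MvPolynomial (Fin n) k)[X]) (w : S) :
    aeval (algebraMap (MvPolynomial (Fin n) k) S (MvPolynomial.C (π ^ d)) * w)
      (derivative (scaleW π d a Φ)) =
      algebraMap (MvPolynomial (Fin n) k) S (MvPolynomial.C (π ^ a * (π ^ d)⁻¹)) *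
        aeval w (derivative Φ) := by
  rw [scaleW, derivative_mul, derivative_C, zero_mul, zero_add, derivative_comp, derivative_mul,
    derivative_C, zero_mul, zero_add, derivative_X, mul_one]
  rw [map_mul, map_mul, aeval_C, aeval_C, aeval_comp, map_mul, aeval_C, aeval_X, ← mul_assoc,
    ← map_mul, ← map_mul]
  congr 2
  rw [← mul_assoc, ← map_mul, ← map_mul, inv_mul_cancel₀ (pow_ne_zero d hπ), map_one, map_one,
    one_mul]

/-- `scaleW Φ` is `k°`-integral for `a ≫ 0`. [folklore] -/
theorem exists_isVInt_scaleW (V : ValuationSubring k) (hdim : ringKrullDim V = 1) {π : k}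
    (hπV : π ∈ V) (hπlt : V.valuation π < 1) (d : ℕ) (Φ : (MvPolynomial (Fin n) k)[X]) :
    ∃ a₀ : ℕ, ∀ a, a₀ ≤ a → IsVInt V (scaleW π d a Φ) :=
  exists_pow_mul_isVInt V hdim hπV hπlt _

end ScaleW

end Polydisc

open Polydisc

/-! ### Integral elements of `m` over the image of `k°` -/

section Integral

variable (V : ValuationSubring k) (O : ValuationSubring m)

/-- `k° → m°` for `m° ∩ k = k°`. [folklore] -/
def VtoO (hO : O.comap (algebraMap k m) = V) : V →+* O :=
  ((algebraMap k m).comp V.subtype).codRestrict O.toSubring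
    fun v => algebraMap_mem_of_comap_eq' V O hO v.2

/-- `(VtoO v : m) = v`. [folklore] -/
@[simp] theorem coe_VtoO (hO : O.comap (algebraMap k m) = V) (v : V) :
    (VtoO V O hO v : m) = algebraMap k m v := rfl

/-- Images of elements of `k°` are integral over `k°_m`. [folklore] -/
theorem isIntegral_algebraMap_of_mem {c : k} (hc : c ∈ V) :
    IsIntegral (baseRing m V) (algebraMap k m c) :=
  isIntegral_algebraMap (R := baseRing m V) (x := ⟨algebraMap k m c, ⟨c, hc, rfl⟩⟩)

/-- `π^N / o` is integral over `k°` for some `N`, for `o ≠ 0` (height one). [folklore] -/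
theorem exists_pow_eq_mul_integral [Algebra.IsAlgebraic k m] (hdim : ringKrullDim V = 1)
    {π : k} (hπV : π ∈ V) (hπ : V.valuation π < 1) {o : m} (ho0 : o ≠ 0) :
    ∃ (N : ℕ) (o' : m), IsIntegral (baseRing m V) o' ∧ algebraMap k m π ^ N = o * o' := by
  obtain ⟨M, hM⟩ := exists_pow_mul_isIntegral V hdim hπV hπ o⁻¹
  exact ⟨M, algebraMap k m π ^ M * o⁻¹, hM, by rw [mul_left_comm, mul_inv_cancel₀ ho0, mul_one]⟩

end Integral

/-! ### The integral data of the chart -/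

namespace DecompChart

variable {V : ValuationSubring k} {O : ValuationSubring m} {A : Subring K}
  {φ : Algebra.adjoin k (A : Set K) →ₐ[k] m} (C : DecompChart V O A φ)

include C in
/-- `m/k` is algebraic. [folklore] -/
theorem isAlgebraic_m : Algebra.IsAlgebraic k m := by
  haveI := C.hfin; exact Algebra.IsAlgebraic.of_finite k m

/-- `π` as an element of `Rh` is `π`. [folklore] -/
theorem algebraMap_Rh_coe (c : k) : ((algebraMap k C.Rh c : C.Rh) : K) = algebraMap k K c := rfl

/-- The exponent `d` making `π^d w₀` integral over `k°`. [folklore] -/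
theorem exists_dW : ∃ d : ℕ, IsIntegral (baseRing m V) (algebraMap k m C.π ^ d * C.w₀) := by
  haveI := C.isAlgebraic_m
  exact exists_pow_mul_isIntegral V C.hdim C.hπV C.hπlt C.w₀

/-- `d = d_w`. [folklore] -/
def dW : ℕ := C.exists_dW.choose

/-- The rescaled generator `w′ = π^d w ∈ Rh`. [folklore] -/
def w' : C.Rh := algebraMap k C.Rh (C.π ^ C.dW) * C.P.x

/-- `w′ = π^d · w` with the scalar written through `k[X]`. [folklore] -/
theorem w'_eq : C.w' = algebraMap (MvPolynomial (Fin C.n) k) C.Rh (MvPolynomial.C (C.π ^ C.dW)) *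
    C.P.x := by
  rw [w', ← MvPolynomial.algebraMap_eq, ← IsScalarTower.algebraMap_apply]

/-- The value `w₀′ = π^d w₀` of `w′` at the point. [folklore] -/
def w₀' : m := C.φh C.w'

/-- `w₀′ = π^d w₀`. [folklore] -/
theorem w₀'_eq : C.w₀' = algebraMap k m C.π ^ C.dW * C.w₀ := by
  rw [w₀', w', map_mul, AlgHom.commutes, map_pow]; rfl

/-- `w₀′` is integral over `k°`. [folklore] -/
theorem w₀'_isIntegral : IsIntegral (baseRing m V) C.w₀' := by
  rw [C.w₀'_eq]; exact C.exists_dW.choose_spec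

/-- `w₀′ ∈ m°`. [folklore] -/
theorem w₀'_mem : C.w₀' ∈ O := mem_of_isIntegral_map V O C.hOV C.w₀'_isIntegral

/-! #### The integral rescalings `F₁, G₁` of `F, G` -/

/-- Exponent `a_F`. [folklore] -/
theorem exists_aF : ∃ a : ℕ, C.dW ≤ a ∧ IsVInt V (scaleW C.π C.dW a C.P.f) := by
  obtain ⟨a₀, ha₀⟩ := exists_isVInt_scaleW V C.hdim C.hπV C.hπlt C.dW C.P.f
  exact ⟨max a₀ C.dW, le_max_right _ _, ha₀ _ (le_max_left _ _)⟩

/-- `a_F`. [folklore] -/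
def aF : ℕ := C.exists_aF.choose

/-- `d ≤ a_F`. [folklore] -/
theorem dW_le_aF : C.dW ≤ C.aF := C.exists_aF.choose_spec.1

/-- `F₁ = π^{a_F} F(X, W/π^d)` — `k°`-integral, vanishing at `(T, w′)`. [folklore] -/
def F₁ : (MvPolynomial (Fin C.n) k)[X] := scaleW C.π C.dW C.aF C.P.f

/-- `F₁` is `k°`-integral. [folklore] -/
theorem isVInt_F₁ : IsVInt V C.F₁ := C.exists_aF.choose_spec.2

/-- `F₁(T, w′) = 0`. [folklore] -/
theorem aeval_w'_F₁ : aeval C.w' C.F₁ = 0 := by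
  rw [w'_eq, F₁, aeval_scaleW C.hπ0, C.aeval_x_f, mul_zero]

/-- `∂_W F₁(T, w′) = π^{a_F} (π^d)⁻¹ · F_W(T, w)`. [folklore] -/
theorem aeval_w'_derivative_F₁ : aeval C.w' (derivative C.F₁) =
    algebraMap (MvPolynomial (Fin C.n) k) C.Rh (MvPolynomial.C (C.π ^ C.aF * (C.π ^ C.dW)⁻¹)) *
      aeval C.P.x (derivative C.P.f) := by
  rw [w'_eq, F₁, aeval_derivative_scaleW C.hπ0]

/-- `∂_W F₁(T, w′)` does not vanish at the point. [folklore] -/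
theorem φh_aeval_w'_derivative_F₁_ne_zero : C.φh (aeval C.w' (derivative C.F₁)) ≠ 0 := by
  rw [C.aeval_w'_derivative_F₁, map_mul, ← MvPolynomial.algebraMap_eq,
    ← IsScalarTower.algebraMap_apply, AlgHom.commutes]
  refine mul_ne_zero ?_ ?_
  · rw [map_ne_zero_iff _ (algebraMap k m).injective]
    exact mul_ne_zero (pow_ne_zero _ C.hπ0) (inv_ne_zero (pow_ne_zero _ C.hπ0))
  · exact (C.P.hasMap.isUnit_derivative_f.map C.φh).ne_zero

/-- The lift `F_V` of `F₁` to `k°[X₁,…,X_n][W]`. [folklore] -/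
def FV : (MvPolynomial (Fin C.n) V)[X] := C.isVInt_F₁.exists_lift.choose

/-- `F_V ↦ F₁`. [folklore] -/
theorem map_FV : C.FV.map (MvPolynomial.map (algebraMap V k)) = C.F₁ :=
  C.isVInt_F₁.exists_lift.choose_spec

/-- Exponent `a_G`. [folklore] -/
theorem exists_aG : ∃ a : ℕ, IsVInt V (scaleW C.π C.dW a C.P.g) := by
  obtain ⟨a₀, ha₀⟩ := exists_isVInt_scaleW V C.hdim C.hπV C.hπlt C.dW C.P.g
  exact ⟨a₀, ha₀ _ le_rfl⟩

/-- `a_G`. [folklore] -/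
def aG : ℕ := C.exists_aG.choose

/-- `G₁ = π^{a_G} G(X, W/π^d)` — `k°`-integral, a unit at `(T, w′)`. [folklore] -/
def G₁ : (MvPolynomial (Fin C.n) k)[X] := scaleW C.π C.dW C.aG C.P.g

/-- `G₁` is `k°`-integral. [folklore] -/
theorem isVInt_G₁ : IsVInt V C.G₁ := C.exists_aG.choose_spec

/-- `G₁(T, w′) = π^{a_G} G(T, w)`. [folklore] -/
theorem aeval_w'_G₁ : aeval C.w' C.G₁ =
    algebraMap (MvPolynomial (Fin C.n) k) C.Rh (MvPolynomial.C (C.π ^ C.aG)) *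
      aeval C.P.x C.P.g := by
  rw [w'_eq, G₁, aeval_scaleW C.hπ0]

/-- `G₁(T, w′)` is a unit of `Rh`. [folklore] -/
theorem isUnit_aeval_w'_G₁ : IsUnit (aeval C.w' C.G₁) := by
  rw [C.aeval_w'_G₁]
  refine IsUnit.mul ?_ C.isUnit_aeval_g
  rw [← MvPolynomial.algebraMap_eq, ← IsScalarTower.algebraMap_apply]
  exact (IsUnit.mk0 _ (pow_ne_zero _ C.hπ0)).map _

/-- The lift `G_V` of `G₁`. [folklore] -/
def GV : (MvPolynomial (Fin C.n) V)[X] := C.isVInt_G₁.exists_lift.choose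

/-- `G_V ↦ G₁`. [folklore] -/
theorem map_GV : C.GV.map (MvPolynomial.map (algebraMap V k)) = C.G₁ :=
  C.isVInt_G₁.exists_lift.choose_spec

/-! #### Values at the point -/

/-- The value at the point of a `k°`-integral polynomial is the image of its `k°_m`-value:
`φh(Ψ_k(T, w′)) = (k → m)(…)` computed through `pointVal`. Precisely, for `Ψ_V` over `k°`:
`φh(aeval w′ Ψ_k) = pointVal (Ψ_V ↦ m) w₀′`. [folklore] -/
theorem φh_aeval_w'_map (ΨV : (MvPolynomial (Fin C.n) V)[X]) :
    C.φh (aeval C.w' (ΨV.map (MvPolynomial.map (algebraMap V k)))) =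
      pointVal (ΨV.map (MvPolynomial.map ((algebraMap k m).comp (algebraMap V k)))) C.w₀' := by
  have hφ : (C.φh : C.Rh →+* m).comp (algebraMap (MvPolynomial (Fin C.n) k) C.Rh) =
      (algebraMap k m).comp MvPolynomial.constantCoeff := by
    ext q
    · change C.φh (algebraMap _ C.Rh (MvPolynomial.C q)) = algebraMap k m (MvPolynomial.constantCoeff
        (MvPolynomial.C q))
      rw [C.φh_algebraMap]
    · change C.φh (algebraMap _ C.Rh (MvPolynomial.X q)) = algebraMap k m (MvPolynomial.constantCoeff
        (MvPolynomial.X q))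
      rw [C.φh_algebraMap]
  rw [Polynomial.aeval_def, Polynomial.eval₂_map, ← AlgHom.coe_toRingHom, Polynomial.hom_eval₂,
    ← RingHom.comp_assoc, hφ, RingHom.comp_assoc, MvPolynomial.constantCoeff_comp_map,
    pointVal_eq, Polynomial.map_map, Polynomial.eval_map, MvPolynomial.constantCoeff_comp_map,
    RingHom.comp_assoc]
  rfl

/-- `k° → m°`. [folklore] -/
abbrev vO : V →+* O := VtoO V O C.hOV

/-- `F_O`: `F₁` over `m°`. [folklore] -/
def FO : (MvPolynomial (Fin C.n) O)[X] := C.FV.map (MvPolynomial.map C.vO)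

/-- `G_O`: `G₁` over `m°`. [folklore] -/
def GO : (MvPolynomial (Fin C.n) O)[X] := C.GV.map (MvPolynomial.map C.vO)

/-- `w₀′ ∈ m°` as an element. [folklore] -/
def w₀'O : O := ⟨C.w₀', C.w₀'_mem⟩

/-- `(m° ⊆ m) ∘ (k° → m°) = (k → m) ∘ (k° ⊆ k)`. [folklore] -/
theorem subtype_comp_vO : O.subtype.comp C.vO = (algebraMap k m).comp (algebraMap V k) := by
  ext v; rfl

/-- Values over `m°` versus values at the point: for `Ψ_V` over `k°`,
`(pointVal (Ψ_V ↦ m°) w₀′ : m) = φh(aeval w′ Ψ_k)`. [folklore] -/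
theorem coe_pointVal_map (ΨV : (MvPolynomial (Fin C.n) V)[X]) :
    ((pointVal (ΨV.map (MvPolynomial.map C.vO)) C.w₀'O : O) : m) =
      C.φh (aeval C.w' (ΨV.map (MvPolynomial.map (algebraMap V k)))) := by
  rw [C.φh_aeval_w'_map, show ((pointVal (ΨV.map (MvPolynomial.map C.vO)) C.w₀'O : O) : m) =
      O.subtype (pointVal (ΨV.map (MvPolynomial.map C.vO)) C.w₀'O) from rfl, map_pointVal,
    Polynomial.map_map]
  have hmaps : (MvPolynomial.map (σ := Fin C.n) O.subtype).comp (MvPolynomial.map C.vO) =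
      MvPolynomial.map ((algebraMap k m).comp (algebraMap V k)) := by
    rw [← C.subtype_comp_vO]
    ext q
    · simp
    · simp
  rw [hmaps]
  rfl

/-- Same for derivatives. [folklore] -/
theorem coe_pointVal_derivative_map (ΨV : (MvPolynomial (Fin C.n) V)[X]) :
    ((pointVal (derivative (ΨV.map (MvPolynomial.map C.vO))) C.w₀'O : O) : m) =
      C.φh (aeval C.w' (derivative (ΨV.map (MvPolynomial.map (algebraMap V k))))) := by
  have h1 : derivative (ΨV.map (MvPolynomial.map C.vO)) = (derivative ΨV).map (MvPolynomial.map C.vO) :=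
    Polynomial.derivative_map _ _
  have h2 : derivative (ΨV.map (MvPolynomial.map (algebraMap V k))) =
      (derivative ΨV).map (MvPolynomial.map (algebraMap V k)) := Polynomial.derivative_map _ _
  rw [h1, h2, C.coe_pointVal_map]

/-- **`c₀′ = ∂_W F₁(0, w₀′) ∈ m°`**, the Newton constant of the chart. [folklore] -/
def c₀' : O := pointVal (derivative C.FO) C.w₀'O

/-- `c₀′` is the value at the point of `∂_W F₁(T, w′)`. [folklore] -/
theorem coe_c₀' : (C.c₀' : m) = C.φh (aeval C.w' (derivative C.F₁)) := by
  rw [c₀', FO, C.coe_pointVal_derivative_map, C.map_FV]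

/-- `c₀′ ≠ 0`. [folklore] -/
theorem c₀'_ne_zero : (C.c₀' : m) ≠ 0 := by
  rw [C.coe_c₀']; exact C.φh_aeval_w'_derivative_F₁_ne_zero

/-- `F_O(0, w₀′) = 0`. [folklore] -/
theorem pointVal_FO : pointVal C.FO C.w₀'O = 0 := by
  apply Subtype.ext
  rw [FO, C.coe_pointVal_map, C.map_FV, C.aeval_w'_F₁, map_zero]; rfl

/-- **`g₀′ = G₁(0, w₀′) ∈ m°`**. [folklore] -/
def g₀' : O := pointVal C.GO C.w₀'O

/-- `g₀′` is the value at the point of `G₁(T, w′)`. [folklore] -/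
theorem coe_g₀' : (C.g₀' : m) = C.φh (aeval C.w' C.G₁) := by
  rw [g₀', GO, C.coe_pointVal_map, C.map_GV]

/-- `g₀′ ≠ 0`. [folklore] -/
theorem g₀'_ne_zero : (C.g₀' : m) ≠ 0 := by
  rw [C.coe_g₀']; exact (C.isUnit_aeval_w'_G₁.map C.φh).ne_zero

/-- `ι₀` with `c₀′ ι₀ = π^{N₀}`, integral over `k°`. [folklore] -/
theorem exists_ι₀ : ∃ (N : ℕ) (ι : m), IsIntegral (baseRing m V) ι ∧
    (C.c₀' : m) * ι = algebraMap k m C.π ^ N := by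
  haveI := C.isAlgebraic_m
  obtain ⟨N, ι, hι, h⟩ := exists_pow_eq_mul_integral V C.hdim C.hπV C.hπlt C.c₀'_ne_zero
  exact ⟨N, ι, hι, h.symm⟩

/-- `N₀`. [folklore] -/
def N₀ : ℕ := C.exists_ι₀.choose

/-- `ι₀ = π^{N₀}/c₀′`. [folklore] -/
def ι₀ : m := C.exists_ι₀.choose_spec.choose

/-- `ι₀` is integral over `k°`. [folklore] -/
theorem ι₀_isIntegral : IsIntegral (baseRing m V) C.ι₀ := C.exists_ι₀.choose_spec.choose_spec.1

/-- `ι₀ ∈ m°`. [folklore] -/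
theorem ι₀_mem : C.ι₀ ∈ O := mem_of_isIntegral_map V O C.hOV C.ι₀_isIntegral

/-- `c₀′ ι₀ = π^{N₀}`. [folklore] -/
theorem c₀'_mul_ι₀ : (C.c₀' : m) * C.ι₀ = algebraMap k m C.π ^ C.N₀ :=
  C.exists_ι₀.choose_spec.choose_spec.2

/-- `κ₀` with `g₀′ κ₀ = π^{N_g}`, integral over `k°`. [folklore] -/
theorem exists_κ₀ : ∃ (N : ℕ) (κ : m), IsIntegral (baseRing m V) κ ∧
    (C.g₀' : m) * κ = algebraMap k m C.π ^ N := by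
  haveI := C.isAlgebraic_m
  obtain ⟨N, κ, hκ, h⟩ := exists_pow_eq_mul_integral V C.hdim C.hπV C.hπlt C.g₀'_ne_zero
  exact ⟨N, κ, hκ, h.symm⟩

/-- `N_g`. [folklore] -/
def Ng : ℕ := C.exists_κ₀.choose

/-- `κ₀ = π^{N_g}/g₀′`. [folklore] -/
def κ₀ : m := C.exists_κ₀.choose_spec.choose

/-- `κ₀` is integral over `k°`. [folklore] -/
theorem κ₀_isIntegral : IsIntegral (baseRing m V) C.κ₀ := C.exists_κ₀.choose_spec.choose_spec.1

/-- `κ₀ ∈ m°`. [folklore] -/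
theorem κ₀_mem : C.κ₀ ∈ O := mem_of_isIntegral_map V O C.hOV C.κ₀_isIntegral

/-- `g₀′ κ₀ = π^{N_g}`. [folklore] -/
theorem g₀'_mul_κ₀ : (C.g₀' : m) * C.κ₀ = algebraMap k m C.π ^ C.Ng :=
  C.exists_κ₀.choose_spec.choose_spec.2

/-! #### Integral representations of elements of `Rh` -/

section Rep

variable (z : C.Rh)

/-- The numerator `Φ_z` of a representation `z · G(T,w)^N = Φ_z(T, w)`. [folklore] -/
def repΦ : (MvPolynomial (Fin C.n) k)[X] := (C.exists_rep z).choose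

/-- The exponent `N_z`. [folklore] -/
def repN : ℕ := (C.exists_rep z).choose_spec.choose

/-- `z · G(T, w)^{N_z} = Φ_z(T, w)`. [folklore] -/
theorem rep_spec : z * (aeval C.P.x C.P.g) ^ C.repN z = aeval C.P.x (C.repΦ z) :=
  (C.exists_rep z).choose_spec.choose_spec

/-- Exponent `a_z` making `π^{a_z} Φ_z(X, W/π^d)` integral. [folklore] -/
theorem exists_repa : ∃ a : ℕ, IsVInt V (scaleW C.π C.dW a (C.repΦ z)) := by
  obtain ⟨a₀, ha₀⟩ := exists_isVInt_scaleW V C.hdim C.hπV C.hπlt C.dW (C.repΦ z)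
  exact ⟨a₀, ha₀ _ le_rfl⟩

/-- `a_z`. [folklore] -/
def repa : ℕ := (C.exists_repa z).choose

/-- `Φ_{z,1} = π^{a_z} Φ_z(X, W/π^d)` — integral. [folklore] -/
def repΦ₁ : (MvPolynomial (Fin C.n) k)[X] := scaleW C.π C.dW (C.repa z) (C.repΦ z)

/-- `Φ_{z,1}` is integral. [folklore] -/
theorem isVInt_repΦ₁ : IsVInt V (C.repΦ₁ z) := (C.exists_repa z).choose_spec

/-- The lift of `Φ_{z,1}` to `k°`. [folklore] -/
def repΦV : (MvPolynomial (Fin C.n) V)[X] := (C.isVInt_repΦ₁ z).exists_lift.choose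

/-- `Φ_{z,V} ↦ Φ_{z,1}`. [folklore] -/
theorem map_repΦV : (C.repΦV z).map (MvPolynomial.map (algebraMap V k)) = C.repΦ₁ z :=
  (C.isVInt_repΦ₁ z).exists_lift.choose_spec

/-- `Φ_{z,O}`: the numerator over `m°`. [folklore] -/
def repΦO : (MvPolynomial (Fin C.n) O)[X] := (C.repΦV z).map (MvPolynomial.map C.vO)

/-- The exponent `b_z = a_z + N_z N_g`. [folklore] -/
def repb : ℕ := C.repa z + C.repN z * C.Ng

/-- **The rescaled representation**: `Φ_{z,1}(T, w′) · π^{N_z a_G} = π^{a_z} · z · G₁(T, w′)^{N_z}`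
in `Rh`. [folklore] -/
theorem aeval_w'_repΦ₁ :
    aeval C.w' (C.repΦ₁ z) * algebraMap k C.Rh (C.π ^ (C.repN z * C.aG)) =
      algebraMap k C.Rh (C.π ^ C.repa z) * z * (aeval C.w' C.G₁) ^ C.repN z := by
  rw [repΦ₁, w'_eq, aeval_scaleW C.hπ0, ← C.rep_spec z, ← w'_eq, C.aeval_w'_G₁,
    ← MvPolynomial.algebraMap_eq, ← IsScalarTower.algebraMap_apply,
    ← IsScalarTower.algebraMap_apply, mul_pow]
  simp only [map_pow]
  ring

/-- **The value identity** feeding `Ztilde`: `Φ_{z,O}(0, w₀′) · κ₀^{N_z} · π^{N_z a_G}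
= π^{b_z} · z(x)` in `m`. [folklore] -/
theorem pointVal_repΦO_mul :
    ((pointVal (C.repΦO z) C.w₀'O : O) : m) * (C.κ₀ ^ C.repN z * algebraMap k m C.π ^ (C.repN z * C.aG)) =
      algebraMap k m C.π ^ C.repb z * C.φh z := by
  rw [repΦO, C.coe_pointVal_map, C.map_repΦV]
  have h := congrArg C.φh (C.aeval_w'_repΦ₁ z)
  simp only [map_mul, map_pow, AlgHom.commutes] at h
  rw [← C.coe_g₀'] at h
  -- `h : φh(Φ₁(w′)) π^{N a_G} = π^{a} φh(z) g₀′^N`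
  have hκN : ((C.g₀' : m) * C.κ₀) ^ C.repN z = (algebraMap k m C.π ^ C.Ng) ^ C.repN z := by
    rw [C.g₀'_mul_κ₀]
  rw [repb, pow_add]
  linear_combination C.κ₀ ^ C.repN z * h + (algebraMap k m C.π) ^ C.repa z * C.φh z * hκN

end Rep

end DecompChart


end Literature.AlgebraicGeometry.Resolution
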